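import Summits.NavierStokesRegularity.NavierStokesRegularity.Theses.HardyPointSink
import Literature.Analysis.FluidPDE.LocalTypeIReverseZoom
import Literature.Analysis.FluidPDE.Seregin2020CubicLowerBound

/-!
# Route HardyPointSink — crux `NoHardyTypeIAncient` (stmt-NavierStokesRegularity-7980), line `birth`:
# the `ε`-gap certificate for Albritton–Barker's Type-I quantity

Summit-side proof file (stub `hardyPointSink_cert_smallTypeI` of the registered skeleton
`Cruxes/NoHardyTypeIAncient/Lines/birth.lean`). Statement: there is a universal `ε > 0` such that
every suitable weak solution `(u, p)` of Navier–Stokes (`ν = 1`, no force) on the slab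
`(−∞, 0) × ℝ³`, with weak spatial gradient `G` and Albritton–Barker Type-I quantity
`𝐈 = typeIBound (Iio 0 ×ˢ univ) u p G < ε`, vanishes a.e. on the slab.

Proof. Take `ε = ε₀³` with `ε₀, C₀` the constants of the one-scale ε-regularity criterion at
top-touching cylinders (`Seregin2020.exists_epsilonRegularity_top`; Caffarelli–Kohn–Nirenberg 1982,
Prop. 1). For a centre `(t₁, x₁)`, `t₁ < 0`, and a scale `c > 0`, the Navier–Stokes zoom
`v = c u(t₁ + c² s, x₁ + c y)` with its pressure normalised to mean zero on `B(0, 1)` is a suitable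
weak solution in `Q(0, 1)` (`isSuitableWeakSolutionInBall_zoom`) with
`A, E < ∞` and `C(Q(0,1); v) + D(Q(0,1); q) ≤ 𝐈 < ε₀³` (scale invariance,
`abScaledSum_zoom_le_typeIBound`; for the mean-free pressure `D = D_osc`). The criterion gives
`|v| ≤ C₀ ε₀` a.e. on `Q(0, 1/2)`, i.e. `c |u| ≤ C₀ ε₀` a.e. on `Q((t₁, x₁), c/2)` (transport of
a.e. statements along the affine zoom, `ae_restrict_of_ae_restrict_preimage_stAffine`). Along
`c = n + 1`, `t₁ = −1/(n+1)`, `x₁ = 0` the cylinders exhaust the slab and the bounds force `u = 0`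
a.e.

## References

* L. Caffarelli, R. Kohn, L. Nirenberg, CPAM 35 (1982), Prop. 1. [CaffarelliKohnNirenberg1982]
* G. Seregin, Anal. Math. Phys. 10 (2020), Paper 46 = arXiv:2006.04140, Prop. 1.4 (1). [Seregin2020]
* D. Albritton, T. Barker, J. Math. Fluid Mech. 21 (2019) = arXiv:1811.00502, §1, §3.
-/

noncomputable section

set_option linter.dupNamespace false

open MeasureTheory Set Function Filter TopologicalSpace Metric
open scoped ENNReal NNReal Topology

namespace Summit.NavierStokesRegularity.NavierStokesRegularity.Theorems

open Literature.Analysis.FluidPDE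

/-- For a pressure normalised to mean zero on `B(0, 1)` at each time, the plain scaled pressure
quantity `D(Q(0,1))` (no mean subtracted, `cknD`) is Albritton–Barker's mean-free one (`cknDOsc`)
of the un-normalised pressure. [folklore] -/
theorem hardyPointSink_smallTypeI_cknD_sub_average (P : ℝ → EuclideanSpace ℝ (Fin 3) → ℝ) :
    cknD 1 (0 : ℝ × EuclideanSpace ℝ (Fin 3))
        (fun t x => P t x - ⨍ y in ball (0 : EuclideanSpace ℝ (Fin 3)) 1, P t y) =
      cknDOsc 1 0 P :=
  rfl

/-- **The zoomed pair satisfies the hypotheses of the one-scale ε-regularity criterion on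
`Q(0, 1)`.** For a suitable weak solution `(u, p)` on `(−∞, 0) × ℝ³` with weak gradient `G` and
`𝐈 < ∞`, a centre `(t₁, x₁)`, `t₁ < 0`, and a scale `c > 0`: the zoom `v = c u ∘ Φ`,
`Φ(s, y) = (t₁ + c² s, x₁ + c y)`, with the pressure `q = c² p ∘ Φ − [c² p ∘ Φ]_{B(0,1)}`, is a
suitable weak solution on `Q(0, 1)` with weak gradient `c² G ∘ Φ`, finite `A, E, D` there, and
`C(Q(0,1); v) + D(Q(0,1); q) ≤ 𝐈`. [folklore] -/
theorem hardyPointSink_smallTypeI_zoom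
    {u : ℝ → EuclideanSpace ℝ (Fin 3) → EuclideanSpace ℝ (Fin 3)}
    {p : ℝ → EuclideanSpace ℝ (Fin 3) → ℝ}
    {G : ℝ → EuclideanSpace ℝ (Fin 3) → EuclideanSpace ℝ (Fin 3) →L[ℝ] EuclideanSpace ℝ (Fin 3)}
    (hsw : IsSuitableWeakSolutionOn (slab (EuclideanSpace ℝ (Fin 3)) (Iio 0) isOpen_Iio) 1 0 u p)
    (hwg : HasWeakSpatialGradientOn (slab (EuclideanSpace ℝ (Fin 3)) (Iio 0) isOpen_Iio) u G)
    (hI : typeIBound (Iio (0 : ℝ) ×ˢ (univ : Set (EuclideanSpace ℝ (Fin 3)))) u p G ≠ ∞)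
    {c t₁ : ℝ} (hc : 0 < c) (ht₁ : t₁ < 0) (x₁ : EuclideanSpace ℝ (Fin 3)) :
    IsSuitableWeakSolutionOn (parabolicCylinderOpens 1 (0 : ℝ × EuclideanSpace ℝ (Fin 3))) 1 0
        (c • stPull (c ^ 2) c t₁ x₁ u)
        (fun t x => (c ^ 2 • stPull (c ^ 2) c t₁ x₁ p) t x -
          ⨍ y in ball (0 : EuclideanSpace ℝ (Fin 3)) 1, (c ^ 2 • stPull (c ^ 2) c t₁ x₁ p) t y) ∧
      HasWeakSpatialGradientOn (parabolicCylinderOpens 1 (0 : ℝ × EuclideanSpace ℝ (Fin 3)))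
        (c • stPull (c ^ 2) c t₁ x₁ u) (c ^ 2 • stPull (c ^ 2) c t₁ x₁ G) ∧
      cknAEss 1 0 (c • stPull (c ^ 2) c t₁ x₁ u) ≠ ∞ ∧
      cknE 1 0 (c ^ 2 • stPull (c ^ 2) c t₁ x₁ G) ≠ ∞ ∧
      cknD 1 0 (fun t x => (c ^ 2 • stPull (c ^ 2) c t₁ x₁ p) t x -
          ⨍ y in ball (0 : EuclideanSpace ℝ (Fin 3)) 1, (c ^ 2 • stPull (c ^ 2) c t₁ x₁ p) t y) ≠ ∞ ∧
      cknC 1 0 (c • stPull (c ^ 2) c t₁ x₁ u) +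
          cknD 1 0 (fun t x => (c ^ 2 • stPull (c ^ 2) c t₁ x₁ p) t x -
            ⨍ y in ball (0 : EuclideanSpace ℝ (Fin 3)) 1, (c ^ 2 • stPull (c ^ 2) c t₁ x₁ p) t y) ≤
        typeIBound (Iio (0 : ℝ) ×ˢ (univ : Set (EuclideanSpace ℝ (Fin 3)))) u p G := by
  have hle1 := parabolicCylinderOpens_le_stPreimage_slab c ht₁ x₁ 1
  have hball := isSuitableWeakSolutionInBall_zoom hsw hwg hI hc ht₁ x₁
  have hwg1 := (zoom_hasWeakSpatialGradientOn hwg hc t₁ x₁).mono hle1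
  have hbound : abScaledSum 1 0 (c • stPull (c ^ 2) c t₁ x₁ u) (c ^ 2 • stPull (c ^ 2) c t₁ x₁ p)
      (c ^ 2 • stPull (c ^ 2) c t₁ x₁ G) ≤
      typeIBound (Iio (0 : ℝ) ×ˢ (univ : Set (EuclideanSpace ℝ (Fin 3)))) u p G :=
    abScaledSum_zoom_le_typeIBound hc ht₁.le x₁ one_pos le_rfl
  have hD := hardyPointSink_smallTypeI_cknD_sub_average (c ^ 2 • stPull (c ^ 2) c t₁ x₁ p)
  refine ⟨hball.1, hwg1, ne_top_of_le_ne_top hI (cknAEss_le_abScaledSum.trans hbound),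
    ne_top_of_le_ne_top hI (cknE_le_abScaledSum.trans hbound), ?_, ?_⟩
  · rw [hD]
    exact ne_top_of_le_ne_top hI (cknDOsc_le_abScaledSum.trans hbound)
  · rw [hD]
    refine le_trans ?_ hbound
    have h1 : cknC 1 0 (c • stPull (c ^ 2) c t₁ x₁ u) ≤
        cknAEss 1 0 (c • stPull (c ^ 2) c t₁ x₁ u) + cknC 1 0 (c • stPull (c ^ 2) c t₁ x₁ u) :=
      le_add_self
    exact le_add_right (add_le_add h1 le_rfl)

/-- **Unzooming an a.e. bound.** If the zoomed field `v = c u ∘ Φ`, `Φ(s, y) = (t₁ + c² s, x₁ + c y)`,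
satisfies `|v| ≤ K` a.e. on `Q(0, 1/2)`, then `c |u| ≤ K` a.e. on `Q((t₁, x₁), c/2) = Φ(Q(0, 1/2))`
(`Φ` is an affine bijection scaling Lebesgue measure). [folklore] -/
theorem hardyPointSink_smallTypeI_unzoom
    {u : ℝ → EuclideanSpace ℝ (Fin 3) → EuclideanSpace ℝ (Fin 3)} {c : ℝ} (hc : 0 < c) (t₁ : ℝ)
    (x₁ : EuclideanSpace ℝ (Fin 3)) {K : ℝ}
    (h : ∀ᵐ w ∂(volume.restrict (parabolicCylinder (1 / 2) (0 : ℝ × EuclideanSpace ℝ (Fin 3)))),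
      ‖(c • stPull (c ^ 2) c t₁ x₁ u) w.1 w.2‖ ≤ K) :
    ∀ᵐ z ∂(volume.restrict (parabolicCylinder (c / 2) (t₁, x₁))), c * ‖uncurry u z‖ ≤ K := by
  have hc2 : 0 < c ^ 2 := by positivity
  have hpre : stAffine (c ^ 2) c t₁ x₁ ⁻¹' parabolicCylinder (c / 2) (t₁, x₁) =
      parabolicCylinder (1 / 2) (0 : ℝ × EuclideanSpace ℝ (Fin 3)) := by
    have h1 := LocalTypeIScaling.stAffine_preimage_parabolicCylinder hc t₁ x₁ (1 / 2) 0
    have h0 : stAffine (c ^ 2) c t₁ x₁ (0 : ℝ × EuclideanSpace ℝ (Fin 3)) = (t₁, x₁) := by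
      simp [stAffine]
    rwa [h0, mul_one_div] at h1
  refine ae_restrict_of_ae_restrict_preimage_stAffine hc2 hc t₁ x₁
    (P := fun z => c * ‖uncurry u z‖ ≤ K) ?_
  rw [hpre]
  filter_upwards [h] with w hw
  rw [smul_stPull_apply, norm_smul, Real.norm_eq_abs, abs_of_pos hc] at hw
  exact hw

/-- **Exhaustion.** If for every `n` one has `(n + 1) |u| ≤ K` a.e. on the parabolic cylinder
`Q((−1/(n+1), 0), (n+1)/2)`, then `u = 0` a.e. on `(−∞, 0) × ℝ³`: every point of the slab lies in
all but finitely many of these cylinders, and `(n + 1) a ≤ K` for all large `n` forces `a = 0`.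
[folklore] -/
theorem hardyPointSink_smallTypeI_ae_eq_zero
    {u : ℝ → EuclideanSpace ℝ (Fin 3) → EuclideanSpace ℝ (Fin 3)} {K : ℝ}
    (h : ∀ n : ℕ, ∀ᵐ z ∂(volume.restrict (parabolicCylinder (((n : ℝ) + 1) / 2)
      (-(1 / ((n : ℝ) + 1)), (0 : EuclideanSpace ℝ (Fin 3))))), ((n : ℝ) + 1) * ‖uncurry u z‖ ≤ K) :
    uncurry u =ᵐ[volume.restrict (Iio (0 : ℝ) ×ˢ (univ : Set (EuclideanSpace ℝ (Fin 3))))] 0 := by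
  -- gather the countably many a.e. statements into one
  have h' : ∀ᵐ z ∂(volume : Measure (ℝ × EuclideanSpace ℝ (Fin 3))), ∀ n : ℕ,
      z ∈ parabolicCylinder (((n : ℝ) + 1) / 2)
        (-(1 / ((n : ℝ) + 1)), (0 : EuclideanSpace ℝ (Fin 3))) →
        ((n : ℝ) + 1) * ‖uncurry u z‖ ≤ K := by
    rw [ae_all_iff]
    intro n
    exact (ae_restrict_iff' (isOpen_parabolicCylinder _ _).measurableSet).1 (h n)
  rw [EventuallyEq, ae_restrict_iff' (measurableSet_Iio.prod MeasurableSet.univ)]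
  filter_upwards [h'] with z hz hzmem
  have hz1 : z.1 < 0 := hzmem.1
  rw [Pi.zero_apply]
  by_contra hne
  have ha : 0 < ‖uncurry u z‖ := norm_pos_iff.2 hne
  -- choose `n` so large that `z` lies in the `n`-th cylinder and `(n + 1) |u z| > K`
  have ev := tendsto_natCast_atTop_atTop (R := ℝ)
  have evt : ∀ᶠ n : ℕ in atTop, 1 / ((n : ℝ) + 1) < -z.1 :=
    (tendsto_one_div_add_atTop_nhds_zero_nat (𝕜 := ℝ)).eventually_lt_const (neg_pos.2 hz1)
  obtain ⟨n, hn1, hn2, hn3, hn4⟩ : ∃ n : ℕ, -4 * z.1 < n ∧ 1 / ((n : ℝ) + 1) < -z.1 ∧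
      2 * ‖z.2‖ < n ∧ K / ‖uncurry u z‖ < n := by
    obtain ⟨n, h1, h2, h3, h4⟩ := ((ev.eventually_gt_atTop (-4 * z.1)).and (evt.and
      ((ev.eventually_gt_atTop (2 * ‖z.2‖)).and
        (ev.eventually_gt_atTop (K / ‖uncurry u z‖))))).exists
    exact ⟨n, h1, h2, h3, h4⟩
  have hn0 : (0 : ℝ) ≤ n := Nat.cast_nonneg n
  have hq : 0 < 1 / ((n : ℝ) + 1) := by positivity
  have hmem : z ∈ parabolicCylinder (((n : ℝ) + 1) / 2)
      (-(1 / ((n : ℝ) + 1)), (0 : EuclideanSpace ℝ (Fin 3))) := by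
    rw [mem_parabolicCylinder]
    refine ⟨⟨?_, ?_⟩, ?_⟩
    · show -(1 / ((n : ℝ) + 1)) - (((n : ℝ) + 1) / 2) ^ 2 < z.1
      nlinarith [sq_nonneg (n : ℝ)]
    · show z.1 < -(1 / ((n : ℝ) + 1))
      linarith
    · show dist z.2 0 < ((n : ℝ) + 1) / 2
      rw [dist_zero_right]
      linarith
  have hb := hz n hmem
  have hK : K < (n : ℝ) * ‖uncurry u z‖ := (div_lt_iff₀ ha).1 hn4
  have e : ((n : ℝ) + 1) * ‖uncurry u z‖ = (n : ℝ) * ‖uncurry u z‖ + ‖uncurry u z‖ := by ring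
  linarith

/-- **Certificate `hardyPointSink_cert_smallTypeI` (an `ε`-gap for the Type-I quantity).**
There is a universal `ε > 0` such that every suitable weak solution `(u, p)` of Navier–Stokes
(`ν = 1`, no force) on the slab `(−∞, 0) × ℝ³` with weak spatial gradient `G` and
`𝐈(ℝ³ × ℝ₋) = typeIBound (Iio 0 ×ˢ univ) u p G < ε` is a.e. zero on the slab: at every centre
`z₁ = (t₁, x₁)`, `t₁ < 0`, and every scale `c`, the Navier–Stokes zoom
`c u(t₁ + c² s, x₁ + c y)` is suitable in the unit parabolic ball with mean-free pressure and
`C(Q(0,1)) + D(Q(0,1)) ≤ 𝐈` (`isSuitableWeakSolutionInBall_zoom`, scale invariance), so the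
one-scale Caffarelli–Kohn–Nirenberg ε-regularity criterion (Seregin 2020, Prop. 1.4 (1), tree
theorem `Seregin2020.exists_epsilonRegularity_top`, with `ε = ε₀³`) bounds `|u| ≤ C₀ ε₀ / c` a.e. on
`Q(z₁, c/2)`; `c → ∞`. No mildness, no Hardy bound is used. [cite: Seregin2020, Prop. 1.4 (1)] -/
theorem hardyPointSink_cert_smallTypeI :
    ∃ ε : ℝ≥0∞, 0 < ε ∧
    ∀ (u : ℝ → EuclideanSpace ℝ (Fin 3) → EuclideanSpace ℝ (Fin 3))
      (p : ℝ → EuclideanSpace ℝ (Fin 3) → ℝ)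
      (G : ℝ → EuclideanSpace ℝ (Fin 3) → EuclideanSpace ℝ (Fin 3) →L[ℝ] EuclideanSpace ℝ (Fin 3)),
      Literature.Analysis.FluidPDE.IsSuitableWeakSolutionOn
        (Literature.Analysis.FluidPDE.slab (EuclideanSpace ℝ (Fin 3)) (Iio 0) isOpen_Iio) 1 0 u p →
      Literature.Analysis.FluidPDE.HasWeakSpatialGradientOn
        (Literature.Analysis.FluidPDE.slab (EuclideanSpace ℝ (Fin 3)) (Iio 0) isOpen_Iio) u G →
      Literature.Analysis.FluidPDE.typeIBound
        (Iio (0 : ℝ) ×ˢ (univ : Set (EuclideanSpace ℝ (Fin 3)))) u p G < ε →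
      uncurry u =ᵐ[volume.restrict (Iio (0 : ℝ) ×ˢ (univ : Set (EuclideanSpace ℝ (Fin 3))))] 0 := by
  obtain ⟨ε₀, C₀, hε₀, -, H⟩ := Seregin2020.exists_epsilonRegularity_top
  refine ⟨ENNReal.ofReal (ε₀ ^ 3), ENNReal.ofReal_pos.2 (pow_pos hε₀ 3), fun u p G hsw hwg hI => ?_⟩
  refine hardyPointSink_smallTypeI_ae_eq_zero (K := C₀ * ε₀) fun n => ?_
  -- the scale `c = n + 1` and the centre `(t₁, 0)`, `t₁ = -1/(n+1)`
  have hc : (0 : ℝ) < (n : ℝ) + 1 := by positivity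
  have ht₁ : -(1 / ((n : ℝ) + 1)) < 0 := neg_neg_of_pos (by positivity)
  obtain ⟨hsuitQ, hwgQ, hA, hE, hD, hCD⟩ :=
    hardyPointSink_smallTypeI_zoom hsw hwg hI.ne_top hc ht₁ (0 : EuclideanSpace ℝ (Fin 3))
  have hreg := H _ _ _ _ hsuitQ hwgQ 0 1 one_pos (fun _ hw => hw) hA hE hD 1 ε₀ one_pos le_rfl
    hε₀.le le_rfl (hCD.trans hI.le)
  rw [div_one] at hreg
  exact hardyPointSink_smallTypeI_unzoom hc _ _ hreg

end Summit.NavierStokesRegularity.NavierStokesRegularity.Theorems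

end
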